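import Mathlib
import Literature.Analysis.FluidPDE.TypeIAncientMild
import Summits.NavierStokesRegularity.NavierStokesRegularity.Theses.SlicedKelvin

/-!
# Crux `SlicedKelvin.FluxZoom` (stmt-NavierStokesRegularity-15603), line `registered`,
# stub `stub_oseenWindowShift`: the window-regularity package of bounded Oseen-mild fields
# transported from `(0, T)` to an arbitrary window `(a, b)`

Support file (theorems only, `--supports stmt-NavierStokesRegularity-15603`) for the lead's
skeleton of the crux `FluxZoom` of route `SlicedKelvin`. The regularity package of bounded
continuous Oseen-mild fields (KNSS 2009, §4: joint smoothness, divergence-free slices, uniform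
derivative bounds `‖∇ᵏV(t, x)‖ ≤ C k δ` away from the initial time and the time-Lipschitz bounds
`‖∇ᵏV(t, x) − ∇ᵏV(s, x)‖ ≤ L k δ · |t − s|`, constants uniform in the field) is assumed on the
window `(0, T)` for every `T > 0`; the conclusion is the same package on every window `(a, b)`,
`a < b`, with the constants of the window `(0, b − a)` and the thresholds `a + δ` in place of `δ`.

## Proof

Pure bookkeeping: the Oseen equation is autonomous. Given `V` on `(a, b)` put `W τ := V (τ + a)`
on `(0, b − a)`. Continuity transports along the homeomorphism `(τ, x) ↦ (τ + a, x)`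
(`uncurry W = uncurry V ∘ ((τ, x) ↦ (τ + a, x))`), the slice hypotheses are literal
(`W τ = V (τ + a)`, `τ + a ∈ (a, b)`), and the Oseen identity of `W` between `0 < s < t < b − a` is
the one of `V` between `a < s + a < t + a < b` by the time-translation covariance of the Duhamel
term, `oseenDuhamel_comp_sub_right` with shift `−a`:
`B¹ₛ(W, W)(t) = B¹_{s+a}(V, V)(t + a)`. The package for `W` transfers back through
`V t = W (t − a)` (slices are literally equal functions, so the `iteratedFDeriv` statements are
identical, `|t − s| = |(t − a) − (s − a)|`), and
`uncurry V = uncurry W ∘ ((t, x) ↦ (t − a, x))` for the joint smoothness (`ContDiffOn.comp`, as in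
`IsTypeIAncientMild.comp_sub_right`).

No named fact is assumed: every ingredient is a theorem of the tree or of Mathlib.

## References

* G. Koch, N. Nadirashvili, G. Seregin, V. Šverák, *Liouville theorems for the Navier–Stokes
  equations and applications*, Acta Math. 203 (2009) 83–105 = arXiv:0709.3599, §1 p. 3 (the
  symmetries of the problem) and §4 p. 8 (Prop. 4.1, (4.6), (4.8)–(4.11)).
  [KochNadirashviliSereginSverak2009]
-/

noncomputable section

-- the summit and its single sub-problem share the name (CONVENTIONS §1), as in every Theorems file
set_option linter.dupNamespace false

open Set Function

namespace Summit.NavierStokesRegularity.NavierStokesRegularity.Theorems.FluxZoom.Registered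

open Literature.Analysis.FluidPDE Literature.Analysis

/-- **Continuity on a slab transports under a time shift**: if `uncurry V` is continuous on
`(a, b) × X` then `uncurry (τ ↦ V (τ + a))` is continuous on `(0, b − a) × X`
(composition with `(τ, x) ↦ (τ + a, x)`). -/
theorem oseenWindowShift_continuousOn {X F : Type*} [TopologicalSpace X] [TopologicalSpace F]
    {V : ℝ → X → F} {a b : ℝ} (hcont : ContinuousOn (uncurry V) (Ioo a b ×ˢ univ)) :
    ContinuousOn (uncurry fun τ => V (τ + a)) (Ioo 0 (b - a) ×ˢ univ) := by
  have e : (uncurry fun τ => V (τ + a)) = uncurry V ∘ fun p : ℝ × X => (p.1 + a, p.2) := rfl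
  rw [e]
  refine hcont.comp (by fun_prop) ?_
  intro p hp
  rw [mem_prod, mem_Ioo] at hp ⊢
  exact ⟨⟨by linarith [hp.1.1], by linarith [hp.1.2]⟩, mem_univ _⟩

/-- **Joint smoothness on a slab transports back under a time shift**: if
`uncurry (τ ↦ V (τ + a))` is `C^∞` on `(0, b − a) × X` then `uncurry V` is `C^∞` on `(a, b) × X`
(`uncurry V = uncurry (τ ↦ V (τ + a)) ∘ ((t, x) ↦ (t − a, x))`, `ContDiffOn.comp`; cf.
`IsTypeIAncientMild.comp_sub_right`). -/
theorem oseenWindowShift_contDiffOn {X F : Type*} [NormedAddCommGroup X] [NormedSpace ℝ X]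
    [NormedAddCommGroup F] [NormedSpace ℝ F] {V : ℝ → X → F} {a b : ℝ}
    (h : ContDiffOn ℝ (⊤ : ℕ∞) (uncurry fun τ => V (τ + a)) (Ioo 0 (b - a) ×ˢ univ)) :
    ContDiffOn ℝ (⊤ : ℕ∞) (uncurry V) (Ioo a b ×ˢ univ) := by
  have e : uncurry V = (uncurry fun τ => V (τ + a)) ∘ fun p : ℝ × X => (p.1 - a, p.2) := by
    funext p
    simp only [comp_apply, uncurry, sub_add_cancel]
  rw [e]
  refine h.comp ((contDiff_fst.sub contDiff_const).prodMk contDiff_snd).contDiffOn ?_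
  intro p hp
  rw [mem_prod, mem_Ioo] at hp ⊢
  exact ⟨⟨by linarith [hp.1.1], by linarith [hp.1.2]⟩, mem_univ _⟩

/-- **The Oseen identity is autonomous**: if `V` satisfies
`V(t) = e^{(t−s)Δ}V(s) − B¹ₛ(V, V)(t)` pointwise for all `a < s < t < b`, then `W τ := V (τ + a)`
satisfies it for all `0 < s < t < b − a` (`oseenDuhamel_comp_sub_right` with shift `−a`; KNSS 2009,
§1 p. 3 and §4 p. 8). -/
theorem oseenWindowShift_mild {E : Type*} [NormedAddCommGroup E] [InnerProductSpace ℝ E]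
    [FiniteDimensional ℝ E] [MeasurableSpace E] [BorelSpace E] {V : ℝ → E → E} {a b : ℝ}
    (hmild : ∀ s t : ℝ, a < s → s < t → t < b → ∀ x,
      V t x = UnboundedOperators.heatExtension (V s) (t - s) x - oseenDuhamel 1 s V V t x) :
    ∀ s t : ℝ, 0 < s → s < t → t < b - a → ∀ x,
      (fun τ => V (τ + a)) t x =
        UnboundedOperators.heatExtension ((fun τ => V (τ + a)) s) (t - s) x -
          oseenDuhamel 1 s (fun τ => V (τ + a)) (fun τ => V (τ + a)) t x := by
  intro s t hs hst ht x
  have e1 : oseenDuhamel 1 s (fun τ => V (τ + a)) (fun τ => V (τ + a)) t x =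
      oseenDuhamel 1 (s + a) V V (t + a) x := by
    simpa only [sub_neg_eq_add] using oseenDuhamel_comp_sub_right 1 s t (-a) V V x
  have key := hmild (s + a) (t + a) (by linarith) (by linarith) (by linarith) x
  rw [add_sub_add_right_eq_sub] at key
  simpa only [e1] using key

/-- **stub `stub_oseenWindowShift` of the lead's skeleton** (crux `FluxZoom`, line `registered`):
the window-regularity package of bounded continuous Oseen-mild fields (joint smoothness,
divergence-free slices, uniform derivative bounds and time-Lipschitz bounds of all spatial
derivatives away from the initial time, constants uniform in the field; KNSS 2009, §4) on the
windows `(0, T)` implies the same package on every window `(a, b)`, `a < b`, with thresholds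
`a + δ`: the Oseen equation is autonomous, so `τ ↦ V (τ + a)` is a bounded continuous Oseen-mild
field on `(0, b − a)` (`oseenWindowShift_mild`), and the package transfers back along
`V t = V ((t − a) + a)`. -/
theorem stub_oseenWindowShift :
    (∀ (N T : ℝ), 0 < T → ∃ (C L : ℕ → ℝ → ℝ),
      ∀ (V : ℝ → EuclideanSpace ℝ (Fin 3) → EuclideanSpace ℝ (Fin 3)),
        ContinuousOn (Function.uncurry V) (Set.Ioo 0 T ×ˢ Set.univ) →
        (∀ t ∈ Set.Ioo 0 T, Literature.Analysis.FluidPDE.IsWeaklyDivFree (V t)) →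
        (∀ t ∈ Set.Ioo 0 T, ∀ x, ‖V t x‖ ≤ N) →
        (∀ s t : ℝ, 0 < s → s < t → t < T → ∀ x,
          V t x = Literature.Analysis.UnboundedOperators.heatExtension (V s) (t - s) x -
            Literature.Analysis.FluidPDE.oseenDuhamel 1 s V V t x) →
        ContDiffOn ℝ (⊤ : ℕ∞) (Function.uncurry V) (Set.Ioo 0 T ×ˢ Set.univ) ∧
        (∀ t ∈ Set.Ioo 0 T, Literature.Analysis.FluidPDE.VectorCalculus.IsDivFree (V t)) ∧
        (∀ δ : ℝ, 0 < δ → ∀ k : ℕ, ∀ t ∈ Set.Ioo δ T, ∀ x,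
          ‖iteratedFDeriv ℝ k (V t) x‖ ≤ C k δ) ∧
        (∀ δ : ℝ, 0 < δ → ∀ k : ℕ, ∀ s ∈ Set.Ioo δ T, ∀ t ∈ Set.Ioo δ T, ∀ x,
          ‖iteratedFDeriv ℝ k (V t) x - iteratedFDeriv ℝ k (V s) x‖ ≤ L k δ * |t - s|)) →
    ∀ (N a b : ℝ), a < b → ∃ (C L : ℕ → ℝ → ℝ),
      ∀ (V : ℝ → EuclideanSpace ℝ (Fin 3) → EuclideanSpace ℝ (Fin 3)),
        ContinuousOn (Function.uncurry V) (Set.Ioo a b ×ˢ Set.univ) →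
        (∀ t ∈ Set.Ioo a b, Literature.Analysis.FluidPDE.IsWeaklyDivFree (V t)) →
        (∀ t ∈ Set.Ioo a b, ∀ x, ‖V t x‖ ≤ N) →
        (∀ s t : ℝ, a < s → s < t → t < b → ∀ x,
          V t x = Literature.Analysis.UnboundedOperators.heatExtension (V s) (t - s) x -
            Literature.Analysis.FluidPDE.oseenDuhamel 1 s V V t x) →
        ContDiffOn ℝ (⊤ : ℕ∞) (Function.uncurry V) (Set.Ioo a b ×ˢ Set.univ) ∧
        (∀ t ∈ Set.Ioo a b, Literature.Analysis.FluidPDE.VectorCalculus.IsDivFree (V t)) ∧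
        (∀ δ : ℝ, 0 < δ → ∀ k : ℕ, ∀ t ∈ Set.Ioo (a + δ) b, ∀ x,
          ‖iteratedFDeriv ℝ k (V t) x‖ ≤ C k δ) ∧
        (∀ δ : ℝ, 0 < δ → ∀ k : ℕ, ∀ s ∈ Set.Ioo (a + δ) b, ∀ t ∈ Set.Ioo (a + δ) b, ∀ x,
          ‖iteratedFDeriv ℝ k (V t) x - iteratedFDeriv ℝ k (V s) x‖ ≤ L k δ * |t - s|) := by
  intro hbox N a b hab
  obtain ⟨C, L, h⟩ := hbox N (b - a) (sub_pos.2 hab)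
  refine ⟨C, L, fun V hcont hdiv hbd hmild => ?_⟩
  -- the package for the shifted field `W τ := V (τ + a)` on the window `(0, b - a)`
  obtain ⟨h1, h2, h3, h4⟩ := h (fun τ => V (τ + a)) (oseenWindowShift_continuousOn hcont)
    (fun t ht => hdiv (t + a) ⟨by linarith [ht.1], by linarith [ht.2]⟩)
    (fun t ht x => hbd (t + a) ⟨by linarith [ht.1], by linarith [ht.2]⟩ x)
    (oseenWindowShift_mild hmild)
  -- transfer back along `V t = W (t - a)`
  have hVW : ∀ t, V t = (fun τ => V (τ + a)) (t - a) := fun t => by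
    simp only [sub_add_cancel]
  refine ⟨oseenWindowShift_contDiffOn h1, fun t ht => ?_, fun δ hδ k t ht x => ?_,
    fun δ hδ k s hs t ht x => ?_⟩
  · rw [hVW t]
    exact h2 (t - a) ⟨by linarith [ht.1], by linarith [ht.2]⟩
  · rw [hVW t]
    exact h3 δ hδ k (t - a) ⟨by linarith [ht.1], by linarith [ht.2]⟩ x
  · have e : t - s = (t - a) - (s - a) := by ring
    rw [hVW t, hVW s, e]
    exact h4 δ hδ k (s - a) ⟨by linarith [hs.1], by linarith [hs.2]⟩ (t - a)
      ⟨by linarith [ht.1], by linarith [ht.2]⟩ x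

end Summit.NavierStokesRegularity.NavierStokesRegularity.Theorems.FluxZoom.Registered
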